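import Mathlib
import Summits.Ventures.HodgeRepro.Tier4.Common.AdelicDefs
import Summits.Ventures.HodgeRepro.Tier4.Common.LocalTorus
import Summits.Ventures.HodgeRepro.Tier4.Common.CongruenceAdeles
import Summits.Ventures.HodgeRepro.Tier4.Common.CompactOpenLevel

/-!
# Tier4/Common/LevelBasis — the principal congruence subgroups `K(N)` form a neighbourhood basis of `1` in `G(𝔸_k)`
(t4-plan-1's WANTED-COMMON S13521 (2) / t4-L1-p3 S13483 (c), the basis half)

Blind re-derivation cell `pub-hodge-repro`, Tier 4 (README §9–§10), seat t4-typer-2 (gen 2).  Target tree path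
`lean/Summits/Ventures/HodgeRepro/Tier4/Common/LevelBasis.lean`.  Imports `CompactOpenLevel` (`congrSet`, `IsCongr`,
`levelK`, `isClosedEmbedding_embed`, `isCompactOpenIn_levelK`) and `CongruenceAdeles` (`modSet`, `modSet_antitone`,
`exists_modSet_subset_nhds_zero`).

PROVED: **`exists_levelK_subset_nhds_one (hV : V ∈ 𝓝 (1 : GA W)) : ∃ N : ℕ, N ≠ 0 ∧ (levelK W N : Set (GA W)) ⊆ V`** and
the packaged **`levelK_compactOpen_basis`** (`K(N)` compact open in `G(𝔸_f)` for every `N ≠ 0`, and a neighbourhood basis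
of `1`).  Kept in its own module because `CompactOpenLevel` is at the 400-line bound for proof files.

Nothing here says anything about the status of the Hodge conjecture for CM abelian varieties, which is NOT proved
(HC_CM is NOT proved by anyone in this repository).
-/

set_option autoImplicit false

noncomputable section

namespace Summit.Ventures.HodgeRepro.Tier4.Common

open NumberField IsDedekindDomain Topology Filter Set Matrix
open scoped NumberField

section Basis

/-! ## `K(N)` is a neighbourhood basis of `1` in `G(𝔸_k)`

Every neighbourhood of `1` in `G(𝔸_k)` contains some `K(N)`, `N ≠ 0` (`exists_levelK_subset_nhds_one`): the topology of
`G(𝔸_k)` is induced by `g ↦ (g, g⁻¹) ∈ M₄(𝔸_k) × M₄(𝔸_k)ᵐᵒᵖ`, a neighbourhood of `1` in `M₄(𝔸_k)` contains a box of entry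
neighbourhoods, and a neighbourhood of an adele `x` contains `x + congrSet k N` for some `N ≠ 0` (the finite-adelic
half is `exists_modSet_subset_nhds_zero` of `CongruenceAdeles`, the archimedean half is the identity).  With
`isCompactOpenIn_levelK` this is the whole of t4-plan-1's WANTED-COMMON S13521 (2): the `K(N)` are compact open subgroups
of `G(𝔸_f)` forming a neighbourhood basis of `1`. -/

variable {k : Type} [Field k] [NumberField k] (W : PlaneData k)

/-- `congrSet` is antitone along divisibility: `M ∣ N ⇒ congrSet N ≤ congrSet M`. -/
theorem congrSet_antitone {M N : ℕ} (h : M ∣ N) : congrSet k N ≤ congrSet k M :=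
  fun _ hx => ⟨hx.1, modSet_antitone k h hx.2⟩

/-- `A ≡ 1 (mod N)` and `M ∣ N` give `A ≡ 1 (mod M)`. -/
theorem IsCongr.of_dvd {M N : ℕ} (h : M ∣ N) {A : M4 k} (hA : IsCongr k N A) : IsCongr k M A :=
  fun i j => congrSet_antitone h (hA i j)

/-- Every neighbourhood of a finite adele `b` contains `b + ∏_v N·𝓞_v` for some `N ≠ 0`. -/
theorem exists_modSet_add_subset {b : FiniteAdeleRing (𝓞 k) k} {B : Set (FiniteAdeleRing (𝓞 k) k)}
    (hB : B ∈ 𝓝 b) : ∃ N : ℕ, N ≠ 0 ∧ ∀ y ∈ modSet k N, y + b ∈ B := by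
  have h0 : (fun y : FiniteAdeleRing (𝓞 k) k => y + b) ⁻¹' B ∈ 𝓝 (0 : FiniteAdeleRing (𝓞 k) k) :=
    (continuous_add_const b).continuousAt.preimage_mem_nhds (by simpa using hB)
  obtain ⟨N, hN, hsub⟩ := exists_modSet_subset_nhds_zero k h0
  exact ⟨N, hN, fun y hy => hsub hy⟩

/-- Every neighbourhood of an adele `x` contains `x + congrSet k N` for some `N ≠ 0`. -/
theorem exists_congrSet_add_subset {x : Ad k} {T : Set (Ad k)} (hT : T ∈ 𝓝 x) :
    ∃ N : ℕ, N ≠ 0 ∧ ∀ y ∈ congrSet k N, y + x ∈ T := by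
  have hT' : T ∈ 𝓝 ((infPart k x, finPart k x) : InfiniteAdeleRing k × FiniteAdeleRing (𝓞 k) k) := hT
  obtain ⟨A, hA, B, hB, hAB⟩ := mem_nhds_prod_iff.1 hT'
  obtain ⟨N, hN, hNB⟩ := exists_modSet_add_subset (k := k) hB
  refine ⟨N, hN, fun y hy => hAB ⟨?_, ?_⟩⟩
  · show infPart k (y + x) ∈ A
    rw [map_add, hy.1, zero_add]
    exact mem_of_mem_nhds hA
  · show finPart k (y + x) ∈ B
    rw [map_add]
    exact hNB _ hy.2

/-- A neighbourhood of `1` in `M₄(𝔸_k)` contains every matrix `≡ 1 (mod N)` for some `N ≠ 0`. -/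
theorem exists_isCongr_subset_nhds_one {U : Set (M4 k)} (hU : U ∈ 𝓝 (1 : M4 k)) :
    ∃ N : ℕ, N ≠ 0 ∧ ∀ A : M4 k, IsCongr k N A → A ∈ U := by
  have hpi : 𝓝 (1 : M4 k) = Filter.pi fun i => 𝓝 ((1 : M4 k) i) := nhds_pi
  rw [hpi] at hU
  obtain ⟨I, -, t, ht, hIt⟩ := Filter.mem_pi.1 hU
  have ht' : ∀ i, t i ∈ Filter.pi fun j => 𝓝 ((1 : M4 k) i j) := fun i => by
    have h := ht i
    rwa [nhds_pi] at h
  choose J _ s hs hJs using fun i => Filter.mem_pi.1 (ht' i)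
  have hentry : ∀ i j, ∃ N : ℕ, N ≠ 0 ∧ ∀ y ∈ congrSet k N, y + (1 : M4 k) i j ∈ s i j :=
    fun i j => exists_congrSet_add_subset (hs i j)
  choose n hn hns using hentry
  refine ⟨∏ i, ∏ j, n i j, ?_, ?_⟩
  · rw [Finset.prod_ne_zero_iff]
    intro i _
    rw [Finset.prod_ne_zero_iff]
    intro j _
    exact hn i j
  · intro A hA
    apply hIt
    intro i _
    apply hJs i
    intro j _
    have hdvd : n i j ∣ ∏ i, ∏ j, n i j :=
      (Finset.dvd_prod_of_mem (n i) (Finset.mem_univ j)).trans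
        (Finset.dvd_prod_of_mem (fun i => ∏ j, n i j) (Finset.mem_univ i))
    have hA' : A i j = (A - 1) i j + (1 : M4 k) i j := by
      rw [Matrix.sub_apply, sub_add_cancel]
    show A i j ∈ s i j
    rw [hA']
    exact hns i j _ (congrSet_antitone hdvd (hA i j))

/-- **`K(N)` is a neighbourhood basis of `1` in `G(𝔸_k)`**: every neighbourhood of `1` contains some `K(N)`, `N ≠ 0`. -/
theorem exists_levelK_subset_nhds_one {V : Set (GA W)} (hV : V ∈ 𝓝 (1 : GA W)) :
    ∃ N : ℕ, N ≠ 0 ∧ (levelK W N : Set (GA W)) ⊆ V := by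
  have hemb := (isClosedEmbedding_embed W).isInducing.nhds_eq_comap (1 : GA W)
  rw [hemb, Filter.mem_comap] at hV
  obtain ⟨S, hS, hSV⟩ := hV
  have h1 : Units.embedProduct (M4 k) ((1 : GA W) : GL4 k) = ((1 : M4 k), MulOpposite.op (1 : M4 k)) := by
    rw [Units.embedProduct_apply]
    simp
  have hS' : S ∈ 𝓝 ((1 : M4 k), MulOpposite.op (1 : M4 k)) := by
    rw [← h1]
    exact hS
  obtain ⟨U₁, hU₁, U₂, hU₂, hU⟩ := mem_nhds_prod_iff.1 hS'
  have hU₂' : MulOpposite.op ⁻¹' U₂ ∈ 𝓝 (1 : M4 k) :=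
    MulOpposite.continuous_op.continuousAt.preimage_mem_nhds hU₂
  obtain ⟨N₁, hN₁, hN₁U⟩ := exists_isCongr_subset_nhds_one (k := k) hU₁
  obtain ⟨N₂, hN₂, hN₂U⟩ := exists_isCongr_subset_nhds_one (k := k) hU₂'
  refine ⟨N₁ * N₂, mul_ne_zero hN₁ hN₂, fun g hg => hSV ?_⟩
  obtain ⟨hg1, hg2⟩ := (mem_levelK W _ g).1 hg
  show Units.embedProduct (M4 k) (g : GL4 k) ∈ S
  apply hU
  rw [Units.embedProduct_apply]
  exact ⟨hN₁U _ (hg1.of_dvd (dvd_mul_right N₁ N₂)), hN₂U _ (hg2.of_dvd (dvd_mul_left N₂ N₁))⟩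

/-- **The `K(N)`, `N ≠ 0`, are compact open subgroups of `G(𝔸_f)` forming a neighbourhood basis of `1`** — t4-plan-1's
WANTED-COMMON S13521 (2) in one statement. -/
theorem levelK_compactOpen_basis :
    (∀ N : ℕ, N ≠ 0 → IsCompactOpenIn W (finitePart W) (levelK W N)) ∧
      ∀ V ∈ 𝓝 (1 : GA W), ∃ N : ℕ, N ≠ 0 ∧ (levelK W N : Set (GA W)) ⊆ V :=
  ⟨fun _ hN => isCompactOpenIn_levelK W hN, fun _ hV => exists_levelK_subset_nhds_one W hV⟩

end Basis

end Summit.Ventures.HodgeRepro.Tier4.Common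

end
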